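import Mathlib.Algebra.Group.Subgroup.Basic
import Mathlib.GroupTheory.Perm.Basic
import Literature.ModelTheory.Quasiminimal.PartialEmbeddings
import HarnessLib

/-!
# The orbit language of a permutation group

Bays–Kirby 2018 (*Pseudo-exponential maps, variants, and quasiminimality*, Algebra & Number
Theory 12 (2018)), Remark 6.6: "All the axioms refer to quantifier-free types with respect to a
particular language, and from QM5a we get the conclusion that if two finite tuples from `M` have
the same quantifier-free type then … they lie in the same automorphism orbit, that is, they have
the same Galois-type." For the countable models `M(F_base)` the language `L^{QE}_{F_base}`
(Def. 6.7) is chosen precisely so that quantifier-free types of finite tuples are Galois types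
(Prop. 6.5, QM5a). This file provides the canonical language with that property for ANY group
`G` of permutations of a set `M` — the **orbit language**: no function symbols, and one `n`-ary
relation symbol `R_y` for every `n`-tuple `y`, interpreted as the `G`-orbit of `y`
(`R_y(x) :⟺ ∃ σ ∈ G, σ ∘ y = x`). Then (all proved):

* `eqQFType_iff_exists` — two `n`-tuples have the same quantifier-free type iff they are
  conjugate under `G` (Galois types = quantifier-free types);
* `isQFEmbOn_iff` — a map is a partial embedding on `A` (`IsQFEmbOn`) iff it agrees with an
  element of `G` on every finite subset of `A` ("locally in `G`");
* `eqQFTypeOver_iff` — `qftp(H, t) = qftp(f H, t')` iff for every finite `s ⊆ H` some `σ ∈ G`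
  agrees with `f` on `s` and maps `t ↦ t'`.

This is the language in which the countable strongly exponentially-algebraically closed models
are quasiminimal pregeometry structures (Bays–Kirby Thm 6.9), with `G` the automorphisms of the
exponential field over the closure of the base.

## Design

The group is supplied through the class `OrbitGroup M` (a subgroup of `Equiv.Perm M`), so that
the interpretation `orbitStructure` is an instance and the quantifier-free-type vocabulary of
`PregeometryStructures.lean` (`EqQFType`, `EqQFTypeOver`, `IsQFEmbOn`) applies verbatim; users
introduce `letI : OrbitGroup M := ⟨G⟩`. For `M : Type` the language lives in `Language.{0, 0}`.

## References

* M. Bays, J. Kirby, *Pseudo-exponential maps, variants, and quasiminimality*, Algebra & Number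
  Theory 12 (2018) 493–549: Prop. 6.5, Remark 6.6, Def. 6.7, Thm 6.9.
* M. Bays, B. Hart, T. Hyttinen, M. Kesälä, J. Kirby, *Quasiminimal structures and excellence*,
  Bull. LMS 46 (2014) 155–163: §2 (Galois types versus quantifier-free types).
-/

noncomputable section

open Set FirstOrder FirstOrder.Language

universe w

namespace Literature.ModelTheory.Quasiminimal

/-! ### The language and its interpretation -/

/-- **The orbit language** of a set `M`: no function symbols, and an `n`-ary relation symbol for
every `n`-tuple `y : Fin n → M` (to be interpreted as the orbit of `y`).
[cite: BaysKirby2018ANT, Remark 6.6 and Def. 6.7] -/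
def orbitLanguage (M : Type w) : Language.{w, w} :=
  ⟨fun _ => PEmpty, fun n => Fin n → M⟩

/-- A distinguished group of permutations of `M` (the "automorphism group" whose orbits are to be
the quantifier-free types). [folklore] -/
class OrbitGroup (M : Type w) where
  /-- the group of permutations -/
  G : Subgroup (Equiv.Perm M)

variable {M : Type w}

/-- **The orbit structure**: the relation symbol `R_y` holds of `x` iff `x = σ ∘ y` for some
`σ ∈ G`. [cite: BaysKirby2018ANT, Remark 6.6] -/
instance orbitStructure [Γ : OrbitGroup M] : (orbitLanguage M).Structure M where
  funMap := fun f _ => PEmpty.elim f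
  RelMap := fun y x => ∃ σ ∈ Γ.G, ⇑σ ∘ y = x

section Basic

variable [Γ : OrbitGroup M]

/-- Unfolding the interpretation of the relation symbols. [folklore] -/
theorem relMap_iff {n : ℕ} (y x : Fin n → M) :
    Structure.RelMap (L := orbitLanguage M) y x ↔ ∃ σ ∈ Γ.G, ⇑σ ∘ y = x :=
  Iff.rfl

/-- Terms of the orbit language are variables: realisation commutes with every map. [folklore] -/
theorem realize_term_comp {β : Type*} (t : (orbitLanguage M).Term β) (σ : M → M) (v : β → M) :
    t.realize (σ ∘ v) = σ (t.realize v) := by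
  cases t with
  | var a => rfl
  | func f _ => exact PEmpty.elim f

/-- The interpretation of a relation symbol is `G`-invariant. [folklore] -/
theorem relMap_comp_iff {n : ℕ} (y x : Fin n → M) {σ : Equiv.Perm M} (hσ : σ ∈ Γ.G) :
    Structure.RelMap (L := orbitLanguage M) y (⇑σ ∘ x) ↔
      Structure.RelMap (L := orbitLanguage M) y x := by
  rw [relMap_iff, relMap_iff]
  constructor
  · rintro ⟨τ, hτ, hτy⟩
    refine ⟨σ⁻¹ * τ, Γ.G.mul_mem (Γ.G.inv_mem hσ) hτ, ?_⟩
    funext i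
    have := congrFun hτy i
    simp only [Function.comp_apply] at this ⊢
    rw [Equiv.Perm.mul_apply, this, Equiv.Perm.inv_eq_iff_eq]
  · rintro ⟨τ, hτ, rfl⟩
    exact ⟨σ * τ, Γ.G.mul_mem hσ hτ, by funext i; simp⟩

/-- Atomic formulas of the orbit language are `G`-invariant. [folklore] -/
theorem realize_iff_of_isAtomic {α : Type*} {φ : (orbitLanguage M).Formula α}
    (hφ : BoundedFormula.IsAtomic φ) {σ : Equiv.Perm M} (hσ : σ ∈ Γ.G) (v : α → M) :
    φ.Realize (⇑σ ∘ v) ↔ φ.Realize v := by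
  have hdef : ∀ (w : α → M), (Sum.elim (⇑σ ∘ w) (default : Fin 0 → M) : α ⊕ Fin 0 → M) =
      ⇑σ ∘ Sum.elim w default := by
    intro w
    funext i
    rcases i with a | i
    · rfl
    · exact i.elim0
  cases hφ with
  | equal t₁ t₂ =>
    change BoundedFormula.Realize (Term.bdEqual t₁ t₂) (⇑σ ∘ v) default ↔
      BoundedFormula.Realize (Term.bdEqual t₁ t₂) v default
    simp only [BoundedFormula.realize_bdEqual]
    rw [hdef, realize_term_comp, realize_term_comp]
    exact σ.injective.eq_iff
  | rel R ts =>
    change BoundedFormula.Realize (Relations.boundedFormula R ts) (⇑σ ∘ v) default ↔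
      BoundedFormula.Realize (Relations.boundedFormula R ts) v default
    simp only [BoundedFormula.realize_rel]
    rw [hdef]
    have : (fun i => (ts i).realize (⇑σ ∘ Sum.elim v default)) =
        ⇑σ ∘ fun i => (ts i).realize (Sum.elim v default) := by
      funext i
      exact realize_term_comp (ts i) σ _
    rw [this]
    exact relMap_comp_iff R _ hσ

/-- Conjugate tuples (indexed by any type) have the same quantifier-free type. [folklore] -/
theorem eqQFType_comp {α : Type*} (v : α → M) {σ : Equiv.Perm M} (hσ : σ ∈ Γ.G) :
    (orbitLanguage M).EqQFType v (⇑σ ∘ v) :=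
  fun _ hφ => (realize_iff_of_isAtomic hφ hσ v).symm

/-- **Quantifier-free types in the orbit language are Galois types**: two `n`-tuples have the same
quantifier-free type iff they are conjugate under `G`.
[cite: BaysKirby2018ANT, Prop. 6.5 (QM5a) and Remark 6.6] -/
theorem eqQFType_iff_exists {n : ℕ} (x x' : Fin n → M) :
    (orbitLanguage M).EqQFType x x' ↔ ∃ σ ∈ Γ.G, ⇑σ ∘ x = x' := by
  constructor
  · intro h
    -- the atomic formula `R_x(v₀, …, v_{n-1})`
    have hat : BoundedFormula.IsAtomic
        (Relations.formula (L := orbitLanguage M) (x : (orbitLanguage M).Relations n)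
          (fun i => var i)) :=
      BoundedFormula.IsAtomic.rel _ _
    have hx : (Relations.formula (L := orbitLanguage M) (x : (orbitLanguage M).Relations n)
        (fun i => var i)).Realize x := by
      rw [Formula.realize_rel]
      exact ⟨1, Γ.G.one_mem, by funext i; simp⟩
    have hx' := (h _ hat).1 hx
    rw [Formula.realize_rel] at hx'
    obtain ⟨σ, hσ, hσx⟩ := hx'
    refine ⟨σ, hσ, ?_⟩
    funext i
    have := congrFun hσx i
    simpa using this
  · rintro ⟨σ, hσ, rfl⟩
    exact eqQFType_comp x hσ

/-- **Partial embeddings in the orbit language are the maps which are locally in `G`**: `f` is a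
partial embedding on `A` iff on every finite tuple from `A` it agrees with some `σ ∈ G`.
[cite: BaysKirby2018ANT, Remark 6.6] -/
theorem isQFEmbOn_iff {f : M → M} {A : Set M} :
    IsQFEmbOn (orbitLanguage M) f A ↔
      ∀ ⦃n : ℕ⦄ (x : Fin n → M), (∀ i, x i ∈ A) → ∃ σ ∈ Γ.G, ⇑σ ∘ x = f ∘ x := by
  constructor
  · intro h n x hx
    exact (eqQFType_iff_exists x (f ∘ x)).1 (h x hx)
  · intro h n x hx
    exact (eqQFType_iff_exists x (f ∘ x)).2 (h x hx)

omit Γ in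
/-- Splitting an equality of appended tuples. [folklore] -/
theorem append_eq_append_iff {m n : ℕ} {s s' : Fin m → M} {t t' : Fin n → M} :
    Fin.append s t = Fin.append s' t' ↔ s = s' ∧ t = t' := by
  constructor
  · intro h
    constructor
    · funext i
      have := congrFun h (Fin.castAdd n i)
      simpa only [Fin.append_left] using this
    · funext i
      have := congrFun h (Fin.natAdd m i)
      simpa only [Fin.append_right] using this
  · rintro ⟨rfl, rfl⟩
    rfl

omit Γ in
/-- Composition distributes over `Fin.append`. [folklore] -/
theorem comp_append {m n : ℕ} (σ : M → M) (s : Fin m → M) (t : Fin n → M) :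
    σ ∘ Fin.append s t = Fin.append (σ ∘ s) (σ ∘ t) := by
  funext i
  refine Fin.addCases (fun j => ?_) (fun j => ?_) i
  · simp
  · simp

/-- **Quantifier-free types over a set in the orbit language**: `qftp(H, t) = qftp(f H, t')` iff
for every finite tuple `s` from `H` some `σ ∈ G` agrees with `f` on `s` and maps `t` to `t'`.
[cite: BaysKirby2018ANT, Remark 6.6] -/
theorem eqQFTypeOver_iff {H : Set M} {f : M → M} {n : ℕ} {t t' : Fin n → M} :
    (orbitLanguage M).EqQFTypeOver H f t t' ↔
      ∀ ⦃m : ℕ⦄ (s : Fin m → M), (∀ i, s i ∈ H) →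
        ∃ σ ∈ Γ.G, ⇑σ ∘ s = f ∘ s ∧ ⇑σ ∘ t = t' := by
  constructor
  · intro h m s hs
    obtain ⟨σ, hσ, hσst⟩ := (eqQFType_iff_exists _ _).1 (h s hs)
    rw [comp_append, append_eq_append_iff] at hσst
    exact ⟨σ, hσ, hσst.1, hσst.2⟩
  · intro h m s hs
    obtain ⟨σ, hσ, hσs, hσt⟩ := h s hs
    refine (eqQFType_iff_exists _ _).2 ⟨σ, hσ, ?_⟩
    rw [comp_append, hσs, hσt]

/-- In particular over a set `H` with the identity matching: `qftp(t/H) = qftp(t'/H)` iff `t`, `t'`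
are conjugate over every finite subset of `H`. [folklore] -/
theorem eqQFTypeOver_id_iff {H : Set M} {n : ℕ} {t t' : Fin n → M} :
    (orbitLanguage M).EqQFTypeOver H id t t' ↔
      ∀ ⦃m : ℕ⦄ (s : Fin m → M), (∀ i, s i ∈ H) →
        ∃ σ ∈ Γ.G, (∀ i, σ (s i) = s i) ∧ ⇑σ ∘ t = t' := by
  rw [eqQFTypeOver_iff]
  refine forall₃_congr fun m s _ => exists_congr fun σ => and_congr_right fun _ =>
    and_congr_left fun _ => ?_
  rw [Function.id_comp]
  exact ⟨fun h i => congrFun h i, fun h => funext h⟩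

end Basic

end Literature.ModelTheory.Quasiminimal
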